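import Literature.AnabelianGeometry.AbsoluteAnabelian.AbsAnabUnitsTransportUnique
import Literature.AnabelianGeometry.AbsoluteAnabelian.AbsAnabProp121viiTransportedCocycleProofs
import Literature.AnabelianGeometry.AbsoluteAnabelian.MLFClosureUnitsInfinitelyDivisible
import Literature.AnabelianGeometry.AbsoluteAnabelian.MonoAnalyticLogShellsSubProofs
import Literature.NumberTheory.GaloisRepresentations.LocalFieldFiniteExtensionIntegers
import Literature.NumberTheory.GaloisRepresentations.LocalExistenceLubinTate
import Literature.IUT.HodgeArakelov.AbsTopMonoidsGenuineProducer
import HarnessLib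

/-!
# [AbsAnab] Prop 1.2.1 (iii)/(vi): the units transport `ψ̄ : K̄₁^× ⥲ K̄₂^×` RESTRICTS to `𝒪^⊳` — and that restriction is
# THE lift of [AbsTopIII] Prop 3.2 (iv) (proof-only; support piece «RESTRICT-𝒪⊳» for abc-iut-L6-t11's RMK321-NAT (N4))

S. Mochizuki, *The Absolute Anabelian Geometry of Hyperbolic Curves* (2004) [AbsAnab], Prop. 1.2.1 (iii) p. 10 («preserves the
images `Im(𝒪×_{K_i})`, `Im(k×_i)`, `Im(K×_i)`»), (vi) p. 10; *Topics in absolute anabelian geometry III*, Prop. 3.2 (iv) p. 72.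
abc-iut seat abc-iut-L6-t13 (gen 4); consumers: abc-iut-L6-t11 g6 (RMK321-NAT, [AbsTopIII] Rmk 3.2.1 naturality), abc-iut-w4-d030
(`GalRigidityInput (AbsTopMonoids.genuineOfModel …)`).

* `Prop121vii.isAbsInteger_iff_exists_pow_eq` — MULTIPLICATIVE integrality criterion in `K̄ˣ`: for a unit `x` of `K̄` and a
  uniformiser `π` of `K`, `x ∈ 𝒪_K̄` iff `x^m = π^n · u` for some `m ≥ 1`, `n : ℕ` and an absolute unit `u` (read in the local
  field `K(x)`: `v(x) ≥ 0 ⟺ x^{e} π^{-v(x)} ∈ 𝒪^×`);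
* `Prop121vii.IsAlphaEquivariant.isAbsInteger_iff` — an `α`-equivariant, uniformiser-preserving `ψ̄` carries `𝒪^⊳_{K̄₁}` onto
  `𝒪^⊳_{K̄₂}` (units are automatic, `IsAlphaEquivariant.preservesAbsUnits`, p419678);
* `Prop121vii.IsAlphaEquivariant.exists_tmPairIso_restrict` — hence `ψ̄` restricts to an isomorphism of the mono-analytic model
  `TM`-pairs `(Gal(K̄₁/K₁) ↷ 𝒪^⊳) ⥲ (Gal(K̄₂/K₂) ↷ 𝒪^⊳)` over `α`;
* `AbsTopMonoids.Genuine.liftM_eq_restrict` — at `K₁ = K₂`, `α = φ`: THE lift `Genuine.liftM C φ` (= `mapOtri` of the genuine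
  `AbsTopMonoids`, p421397) IS the restriction of `ψ̄_φ` to `𝒪^⊳` (uniqueness `Genuine.liftM_unique`).

HONEST FRAMING: classical local-field bookkeeping; nothing here bears on [IUTchIII] Cor. 3.12; no side taken.
-/

noncomputable section

namespace Literature.AnabelianGeometry.AbsoluteAnabelian

namespace Prop121vii

open Field ValuativeRel
open Literature.NumberTheory.GaloisRepresentations
open scoped nonZeroDivisors

universe u

section Integrality

variable (K : Type u) [Field K] [ValuativeRel K] [TopologicalSpace K] [IsNonarchimedeanLocalField K]

/-- **Multiplicative integrality criterion** ([AbsAnab] Prop 1.2.1 (iii) bookkeeping): for a unit `x` of `K̄` and a uniformiser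
`π` of `K`, `x` is integral over `𝒪_K` iff `x^m = π^n · u` for some `m ≥ 1`, `n : ℕ` and `u` with `u, u⁻¹` integral — a condition
stated inside the group `K̄ˣ` with the units and ONE uniformiser of the base. [cite: MochizukiAbsAnab2004, Prop 1.2.1 (iii) p.10] -/
theorem isAbsInteger_iff_exists_pow_eq (π : Kˣ) (hπ : (valuation K).IsUniformizer (π : K)) (x : (AlgebraicClosure K)ˣ) :
    (x : AlgebraicClosure K) ∈ absIntegers 𝒪[K] K ↔
      ∃ (m n : ℕ), 0 < m ∧ ∃ u : (AlgebraicClosure K)ˣ,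
        ((u : AlgebraicClosure K) ∈ absIntegers 𝒪[K] K ∧ (↑u⁻¹ : AlgebraicClosure K) ∈ absIntegers 𝒪[K] K) ∧
        x ^ m = Units.map (algebraMap K (AlgebraicClosure K) : K →* AlgebraicClosure K) π ^ n * u := by
  -- the level field `L = K(x)`, a local field for the prolonged valuation
  set y : AlgebraicClosure K := (x : AlgebraicClosure K) with hy
  have hyint : IsIntegral K y := (Algebra.IsAlgebraic.isAlgebraic y).isIntegral
  let L : IntermediateField K (AlgebraicClosure K) := IntermediateField.adjoin K ({y} : Set (AlgebraicClosure K))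
  haveI : FiniteDimensional K L := IntermediateField.adjoin.finiteDimensional hyint
  letI := FiniteExtension.valuativeRel K L
  letI := FiniteExtension.topologicalSpace K L
  haveI := FiniteExtension.isNonarchimedeanLocalField K L
  -- `x` and `π` as elements of `L`
  let xL : L := IntermediateField.AdjoinSimple.gen K y
  have hxL : (xL : AlgebraicClosure K) = y := rfl
  have hxL0 : xL ≠ 0 := fun h => x.ne_zero (by rw [← hy, ← hxL, h]; rfl)
  let πL : L := algebraMap K L (π : K)
  have hπL : (πL : AlgebraicClosure K) = algebraMap K (AlgebraicClosure K) (π : K) := rfl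
  have hπL0 : πL ≠ 0 := (map_ne_zero _).mpr π.ne_zero
  -- integrality in `K̄` ↔ integrality in `L` ↔ `v_L ≤ 1`
  have hcoe : ∀ z : L, ((z : AlgebraicClosure K) ∈ absIntegers 𝒪[K] K) ↔ z ∈ 𝒪[L] := fun z => by
    rw [FiniteExtension.mem_integer_iff_isIntegral K L]
    exact (IntermediateField.isIntegral_coe_iff K (AlgebraicClosure K) L z).trans Iff.rfl
  have hint : ∀ z : L, ((z : AlgebraicClosure K) ∈ absIntegers 𝒪[K] K) ↔ valuation L z ≤ 1 := fun z => by
    rw [hcoe, Valuation.mem_integer_iff]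
  -- `v_L(π) = g^e` with `e ≥ 1`
  have hπlt : valuation L πL < 1 := by
    have h1 : valuation L πL ≤ 1 :=
      (Valuation.mem_integer_iff _ _).mp ((FiniteExtension.mem_integer_algebraMap_iff K L (π : K)).mpr
        ((Valuation.mem_integer_iff _ _).mpr hπ.val_lt_one.le))
    rcases h1.lt_or_eq with h | h
    · exact h
    · exfalso
      have h2 : πL⁻¹ ∈ 𝒪[L] := by rw [Valuation.mem_integer_iff, map_inv₀, h, inv_one]
      rw [← map_inv₀, FiniteExtension.mem_integer_algebraMap_iff K L, Valuation.mem_integer_iff, map_inv₀] at h2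
      have h3 := hπ.val_lt_one
      have hpos : 0 < valuation K (π : K) := zero_lt_iff.mpr ((Valuation.ne_zero_iff _).mpr π.ne_zero)
      exact absurd ((inv_le_one₀ hpos).mp h2) (not_le.mpr h3)
  obtain ⟨e, he⟩ := exists_valuation_eq_unifValue_zpow L hπL0
  have hanti := zpow_right_strictAnti₀ (unifValue_pos L) (unifValue_lt_one L)
  have he0 : 0 < e := by
    by_contra h
    have h : e ≤ 0 := not_lt.mp h
    have : unifValue L ^ (0 : ℤ) ≤ unifValue L ^ e := hanti.antitone h
    rw [zpow_zero, ← he] at this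
    exact absurd this (not_le.mpr hπlt)
  constructor
  · -- (⇒) `v(x) = g^a`, `a ≥ 0`; `u := x^e / π^a`
    intro hxint
    have hvx : valuation L xL ≤ 1 := (hint xL).mp hxint
    obtain ⟨a, ha⟩ := exists_valuation_eq_unifValue_zpow L hxL0
    have ha0 : 0 ≤ a := by
      by_contra h
      have h : a < 0 := not_le.mp h
      have : unifValue L ^ a > unifValue L ^ (0 : ℤ) := hanti h
      rw [zpow_zero, ← ha] at this
      exact absurd hvx (not_le.mpr this)
    -- the unit `u := x^e π^{-a}` of `L`
    have huv : valuation L (xL ^ e.toNat * (πL ^ a.toNat)⁻¹) = 1 := by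
      rw [map_mul, map_inv₀, map_pow, map_pow, ha, he, ← zpow_natCast, ← zpow_natCast, ← zpow_mul, ← zpow_mul,
        Int.toNat_of_nonneg he0.le, Int.toNat_of_nonneg ha0, mul_comm a e,
        mul_inv_cancel₀ (zpow_ne_zero _ (unifValue_ne_zero L))]
    have huL0 : (xL ^ e.toNat * (πL ^ a.toNat)⁻¹ : L) ≠ 0 := fun h => by
      rw [h, map_zero] at huv; exact zero_ne_one huv
    have huint := (FiniteExtension.valuation_eq_one_iff_mem_integer_and_inv_mem K L huL0).mp huv
    have hu0 : ((xL ^ e.toNat * (πL ^ a.toNat)⁻¹ : L) : AlgebraicClosure K) ≠ 0 := fun h => huL0 (Subtype.ext h)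
    refine ⟨e.toNat, a.toNat, by omega, Units.mk0 _ hu0, ⟨?_, ?_⟩, ?_⟩
    · exact (hcoe _).mpr huint.1
    · rw [Units.val_inv_eq_inv_val, Units.val_mk0, ← IntermediateField.coe_inv]
      exact (hcoe _).mpr huint.2
    · apply Units.ext
      rw [Units.val_pow_eq_pow_val, Units.val_mul, Units.val_pow_eq_pow_val, Units.coe_map, MonoidHom.coe_coe, Units.val_mk0,
        IntermediateField.coe_mul, IntermediateField.coe_inv, IntermediateField.coe_pow, IntermediateField.coe_pow, hxL, hπL, ← hy,
        mul_comm (y ^ e.toNat) _, ← mul_assoc, mul_inv_cancel₀ (pow_ne_zero _ ((map_ne_zero _).mpr π.ne_zero)), one_mul]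
  · -- (⇐) `v(x)^m = v(π)^n ≤ 1 ⇒ v(x) ≤ 1`
    rintro ⟨m, n, hm, u, ⟨hu1, hu2⟩, hxu⟩
    refine (hint xL).mpr ?_
    -- `u = x^m π^{-n}` lies in `L`
    have hu' : u = x ^ m * (Units.map (algebraMap K (AlgebraicClosure K) : K →* AlgebraicClosure K) π ^ n)⁻¹ := by
      rw [hxu, mul_comm, ← mul_assoc, inv_mul_cancel, one_mul]
    have huL : (u : AlgebraicClosure K) = ((xL ^ m * (πL ^ n)⁻¹ : L) : AlgebraicClosure K) := by
      rw [hu', Units.val_mul, Units.val_pow_eq_pow_val, Units.val_inv_eq_inv_val, Units.val_pow_eq_pow_val, Units.coe_map,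
        MonoidHom.coe_coe, IntermediateField.coe_mul, IntermediateField.coe_inv, IntermediateField.coe_pow,
        IntermediateField.coe_pow, hxL, hπL, hy]
    have h0 : (xL ^ m * (πL ^ n)⁻¹ : L) ≠ 0 := mul_ne_zero (pow_ne_zero _ hxL0) (inv_ne_zero (pow_ne_zero _ hπL0))
    have hvu : valuation L (xL ^ m * (πL ^ n)⁻¹) = 1 := by
      rw [FiniteExtension.valuation_eq_one_iff_mem_integer_and_inv_mem K L h0, ← hcoe, ← hcoe,
        IntermediateField.coe_inv, ← huL, ← Units.val_inv_eq_inv_val]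
      exact ⟨hu1, hu2⟩
    rw [map_mul, map_inv₀, map_pow, map_pow,
      mul_inv_eq_one₀ (pow_ne_zero _ ((Valuation.ne_zero_iff _).mpr hπL0))] at hvu
    -- `v(x)^m = v(π)^n ≤ 1`
    have hle : valuation L xL ^ m ≤ 1 := by
      rw [hvu]
      exact pow_le_one₀ zero_le hπlt.le
    by_contra hgt
    exact absurd hle (not_le.mpr (one_lt_pow₀ (not_le.mp hgt) (by omega)))

end Integrality

section Transport

variable {K₁ K₂ : Type u} [Field K₁] [ValuativeRel K₁] [TopologicalSpace K₁] [IsNonarchimedeanLocalField K₁]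
  [Field K₂] [ValuativeRel K₂] [TopologicalSpace K₂] [IsNonarchimedeanLocalField K₂]

/-- **An `α`-equivariant units transport carries `𝒪^⊳_{K̄₁}` onto `𝒪^⊳_{K̄₂}`** ([AbsAnab] Prop 1.2.1 (iii): besides
`Im(𝒪^×)` also the integral elements correspond): for `ψ̄` with the L02 clauses (units ↔ units, uniformisers of `K₁` ↦
uniformisers of `K₂`), `x ∈ 𝒪_{K̄₁}` iff `ψ̄ x ∈ 𝒪_{K̄₂}` — transport of the multiplicative criterion
`isAbsInteger_iff_exists_pow_eq` along `ψ̄` and `ψ̄⁻¹`. [cite: MochizukiAbsAnab2004, Prop 1.2.1 (iii) p.10] -/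
theorem isAbsInteger_iff_of_unitsTransport {ψ : (AlgebraicClosure K₁)ˣ ≃* (AlgebraicClosure K₂)ˣ}
    (hU : PreservesAbsUnits ψ) (hπ : PreservesUniformizers ψ) (x : (AlgebraicClosure K₁)ˣ) :
    (x : AlgebraicClosure K₁) ∈ absIntegers 𝒪[K₁] K₁ ↔ (ψ x : AlgebraicClosure K₂) ∈ absIntegers 𝒪[K₂] K₂ := by
  obtain ⟨π₁, hπ₁⟩ := exists_isUniformizer K₁
  obtain ⟨π₂, hπ₂, hψπ⟩ := hπ π₁ hπ₁
  rw [isAbsInteger_iff_exists_pow_eq K₁ π₁ hπ₁ x, isAbsInteger_iff_exists_pow_eq K₂ π₂ hπ₂ (ψ x)]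
  constructor
  · rintro ⟨m, n, hm, u, hu, hxu⟩
    refine ⟨m, n, hm, ψ u, (hU u).mp hu, ?_⟩
    rw [← map_pow, hxu, map_mul, map_pow, hψπ]
  · rintro ⟨m, n, hm, u, hu, hxu⟩
    refine ⟨m, n, hm, ψ.symm u, ?_, ?_⟩
    · have h := hU (ψ.symm u)
      rw [MulEquiv.apply_symm_apply] at h
      exact h.mpr hu
    · apply ψ.injective
      rw [map_pow, hxu, map_mul, map_pow, hψπ, MulEquiv.apply_symm_apply]

/-- The L02 transport `ψ̄` RESTRICTS to an isomorphism of abc-iut-L4-t2's mono-analytic model `TM`-pairs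
`(Gal(K̄₁/K₁) ↷ 𝒪^⊳_{K̄₁}) ⥲ (Gal(K̄₂/K₂) ↷ 𝒪^⊳_{K̄₂})` over `α` (Galois component `α`, monoid component `ψ̄|_{𝒪^⊳}`):
the pair-level form of [AbsAnab] Prop 1.2.1 (iii)/(vi) = the surjectivity input of [AbsTopIII] Prop 3.2 (iv).
[cite: MochizukiAbsTopIII2015, Proposition 3.2 (iv) p.72] -/
theorem IsAlphaEquivariant.exists_tmPairIso_restrict {α : absoluteGaloisGroup K₁ ≃ₜ* absoluteGaloisGroup K₂}
    {ψ : (AlgebraicClosure K₁)ˣ ≃* (AlgebraicClosure K₂)ˣ} (hψ : IsAlphaEquivariant α ψ) (hU : PreservesAbsUnits ψ)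
    (hπ : PreservesUniformizers ψ) :
    ∃ e : GaloisMonoidPair.Iso (ModelMLFGaloisData.galois K₁ (AlgebraicClosure K₁)).tmPair
        (ModelMLFGaloisData.galois K₂ (AlgebraicClosure K₂)).tmPair,
      (∀ σ : absoluteGaloisGroup K₁, e.isoPi σ = α σ) ∧
      ∀ z : (ModelMLFGaloisData.galois K₁ (AlgebraicClosure K₁)).tmPair.M,
        ((e.isoM z : (ModelMLFGaloisData.galois K₂ (AlgebraicClosure K₂)).tmPair.M) : AlgebraicClosure K₂) =
          ψ (Units.mk0 (z : AlgebraicClosure K₁) z.2.2) := by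
  -- the monoid component: `ψ̄` on `𝒪^⊳ = {integral, ≠ 0}` (as units of `K̄`)
  have hmem : ∀ z : (ModelMLFGaloisData.galois K₁ (AlgebraicClosure K₁)).tmPair.M,
      (ψ (Units.mk0 (z : AlgebraicClosure K₁) z.2.2) : AlgebraicClosure K₂) ∈
        nonzeroIntegers K₂ (AlgebraicClosure K₂) := fun z =>
    ⟨(isAbsInteger_iff_of_unitsTransport hU hπ (Units.mk0 (z : AlgebraicClosure K₁) z.2.2)).mp z.2.1, Units.ne_zero _⟩
  have hmem' : ∀ w : (ModelMLFGaloisData.galois K₂ (AlgebraicClosure K₂)).tmPair.M,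
      (ψ.symm (Units.mk0 (w : AlgebraicClosure K₂) w.2.2) : AlgebraicClosure K₁) ∈
        nonzeroIntegers K₁ (AlgebraicClosure K₁) := fun w => by
    refine ⟨?_, Units.ne_zero _⟩
    have h := isAbsInteger_iff_of_unitsTransport hU hπ (ψ.symm (Units.mk0 (w : AlgebraicClosure K₂) w.2.2))
    rw [MulEquiv.apply_symm_apply] at h
    exact h.mpr w.2.1
  let γ : (ModelMLFGaloisData.galois K₁ (AlgebraicClosure K₁)).tmPair.M ≃*
      (ModelMLFGaloisData.galois K₂ (AlgebraicClosure K₂)).tmPair.M :=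
    { toFun := fun z => ⟨_, hmem z⟩
      invFun := fun w => ⟨_, hmem' w⟩
      left_inv := fun z => Subtype.ext (by
        show ((ψ.symm (Units.mk0 _ _)) : AlgebraicClosure K₁) = z
        have : Units.mk0 ((ψ (Units.mk0 (z : AlgebraicClosure K₁) z.2.2) : AlgebraicClosure K₂)) (hmem z).2 =
            ψ (Units.mk0 (z : AlgebraicClosure K₁) z.2.2) := Units.ext rfl
        rw [this, MulEquiv.symm_apply_apply, Units.val_mk0])
      right_inv := fun w => Subtype.ext (by
        show ((ψ (Units.mk0 _ _)) : AlgebraicClosure K₂) = w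
        have : Units.mk0 ((ψ.symm (Units.mk0 (w : AlgebraicClosure K₂) w.2.2) : AlgebraicClosure K₁)) (hmem' w).2 =
            ψ.symm (Units.mk0 (w : AlgebraicClosure K₂) w.2.2) := Units.ext rfl
        rw [this, MulEquiv.apply_symm_apply, Units.val_mk0])
      map_mul' := fun z z' => Subtype.ext (by
        show ((ψ (Units.mk0 _ _)) : AlgebraicClosure K₂) = (ψ (Units.mk0 _ _) : AlgebraicClosure K₂) * ψ (Units.mk0 _ _)
        rw [← Units.val_mul, ← map_mul]
        congr 2
        exact Units.ext rfl) }
  refine ⟨⟨α, γ, fun σ z => Subtype.ext ?_⟩, fun σ => rfl, fun z => rfl⟩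
  -- equivariance: `ψ̄ (σ • z) = α σ • ψ̄ z` on underlying elements
  let τ : absoluteGaloisGroup K₁ := σ
  show ((ψ (Units.mk0 _ _)) : AlgebraicClosure K₂) = α τ • (ψ (Units.mk0 (z : AlgebraicClosure K₁) z.2.2) : AlgebraicClosure K₂)
  have h1 : Units.mk0 (((σ • z : (ModelMLFGaloisData.galois K₁ (AlgebraicClosure K₁)).tmPair.M)) : AlgebraicClosure K₁)
      (σ • z).2.2 = τ • Units.mk0 (z : AlgebraicClosure K₁) z.2.2 := Units.ext rfl
  rw [h1, hψ τ, Units.coe_smul]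

end Transport

section Restrict

variable {K : Type} [Field K] [ValuativeRel K] [TopologicalSpace K] [IsNonarchimedeanLocalField K] [CharZero K]

/-- **THE lift is the restriction of the L02 transport** (support for [AbsTopIII] Rmk 3.2.1 naturality, abc-iut-L6-t11's
RMK321-NAT (N4)): for a topological automorphism `φ` of `Gal(K̄/K)` and a `φ`-equivariant `ψ̄ : K̄ˣ ⥲ K̄ˣ` with the L02
clauses, abc-iut-L6-t13's `AbsTopMonoids.Genuine.liftM ⟨K, K̄⟩ φ` (= `mapOtri` of the genuine `AbsTopMonoids`,
`genuineOfModel_mapOtri`) acts on `𝒪^⊳_{K̄}` as `ψ̄` (uniqueness of the lift, `Genuine.liftM_unique`).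
[cite: MochizukiAbsTopIII2015, Proposition 3.2 (iv) p.72] -/
theorem liftM_coe_eq_of_unitsTransport {φ : absoluteGaloisGroup K ≃ₜ* absoluteGaloisGroup K}
    {ψ : (AlgebraicClosure K)ˣ ≃* (AlgebraicClosure K)ˣ} (hψ : IsAlphaEquivariant φ ψ) (hU : PreservesAbsUnits ψ)
    (hπ : PreservesUniformizers ψ) (z : (ModelMLFGaloisData.galois K (AlgebraicClosure K)).tmPair.M) :
    ((Literature.IUT.HodgeArakelov.AbsTopMonoids.Genuine.liftM ({ k := K, K := AlgebraicClosure K } : MLFClosure.{0}) φ z :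
        (ModelMLFGaloisData.galois K (AlgebraicClosure K)).tmPair.M) : AlgebraicClosure K) =
      ψ (Units.mk0 (z : AlgebraicClosure K) z.2.2) := by
  obtain ⟨e, heσ, hez⟩ := hψ.exists_tmPairIso_restrict hU hπ
  have huniq := Literature.IUT.HodgeArakelov.AbsTopMonoids.Genuine.liftM_unique
    ({ k := K, K := AlgebraicClosure K } : MLFClosure.{0}) φ e.isoM (fun σ x => by rw [e.smul_comm, heσ]; rfl)
  rw [← huniq, hez]

end Restrict

end Prop121vii

end Literature.AnabelianGeometry.AbsoluteAnabelian

end
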